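import Literature.IUT.HodgeArakelov.BadPlaceSettingAtModelTateYRow
import Literature.AnabelianGeometry.EtaleTheta.ThetaKummerInversionInnerLiftsNoGoTate
import HarnessLib

/-!
# (H1) `hcharY` = F-2633@instance at the stage-2 («Tate shear») models IS the level-2 `y`-parity law `L_Ÿ♯`
# (proof-only; K-L6 row «HCHARY-OF-LY@modelTate»)

S. Mochizuki, *Inter-universal Teichmüller theory II*, kurims manuscript (Dec. 2020) §1, Prop. 1.4 p. 27 ("the open
subgroup `Π_Ÿ(Π) ⊆ Π` corresponding to the tempered covering `Ÿ`") [claim: Mochizuki2012, status: disputed]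
(IUTchII §1 Prop 1.4, kurims p.27); S. Mochizuki, *The étale theta function …*, Publ. RIMS **45** (2009) [EtTh], §1
p. 17 ("`Ÿ := Ÿ₁ = Y₂`", "`K̈ = J̈₁ = K₂`"), Cor. 2.18 (i) p. 60 [cite: MochizukiEtTh2009, Cor 2.18 (i) p.60].
Cell `abc-iut`, K-L6 slice, row «HCHARY-OF-LY@modelTate» (abc-iut-L6-lead gen 8, L6 ROWS #4 2026-08-27T03:53Z), seat
abc-iut-w6-d055 (gen 9).  PROOF-ONLY: no definition, no instance, no new named fact; every input consumed BY NAME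
(abc-iut-L6-t1/L6-d6 `EtaleThetaDataOfSetting.PiYddCharacteristic`, abc-iut-w5-d233 `isTopCharacteristic_GtpY_subgroupOf_Huu_modelχq`,
abc-iut-L2-t5/L2-t6/w5-d249 stage-2 model vocabulary `PiTpχq` / `gfpSnd` / `levelHom` / `dY`, `mem_GtpYdd_modelχq_iff_left`).

THE POINT.  The K-L6 display for [IUTchII] Cor. 1.12 (ii)(iii)@modelTate carries the hypothesis (H1)
`hcharY := EtaleThetaDataOfSetting.PiYddCharacteristic C` ("every topological automorphism of `Π^tp_{X̲̲}` stabilises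
`Π^tp_{Ÿ̲̲} = Π^tp_Ÿ ∩ Π^tp_{X̲̲}`", F-2633 at the instance).  abc-iut-w4-d044's sizing verdict (STATUS 2026-08-27T03:13:48Z)
split it as «Y-clause ∧ L_Ÿ»: the `Y`-clause (`Π^tp_{Y̲̲}` characteristic) is a tree theorem at the stage-2 models
(`ModelTateCarriers.isTopCharacteristic_GtpY_subgroupOf_Huu_modelχq`, from compactness of `Π^tp_Y`), and since
`K₂ = J̈₁ = K̈ = ℚ_p` there, `Π^tp_Ÿ = Π^tp_{Y₂} = {g : deg(g.left) = 0 ∧ ĥ₂(g.left).y = 0}` (every Galois component), so what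
is left is a PARITY LAW on the level-2 `y`-coordinate (the `(Δ^tp_Y)^{ell}`-coordinate mod 2).  abc-iut-w5-d145
(STATUS 03:58:17Z) fixed the exact shape that its finite-group computation certifies (kit j266770, class-2 sweep;
(l, i, j) = (3, 1, 2), every p ≡ 1 (mod 12)) — **L_Ÿ♯**, with `H := Π^tp_{X̲̲} = C.Huu`:
  `∀ α : H ≃ₜ* H, ∀ g : H, gfpSnd (g.left) = 1 → (levelHom 2 (α g).left).y = (levelHom 2 g.left).y`
(on ALL of `Π^tp_Y ∩ H`, Galois components included — the restriction to `Δ^tp_Y ∩ H`, abc-iut-w4-d044's `L_Ÿ`, does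
NOT conversely suffice: the cocycle clause at `inr σ` is extra).  THIS FILE proves, for EVERY prime `p`, EVERY `(i, j)`
with `j` even, EVERY étale-theta datum `E` over `ThetaSetting.modelχq p i j hj`, EVERY `l` and EVERY choice `X̲̲`
(`C : E.DoubleUnderline l`) — no `ι`-stability, no congruence on `p`:
* `piYddCharacteristic_modelχq_of_parity` — **`L_Ÿ♯ ⟹ hcharY`** (the one-term closer the K-L6 certificate wants);
* `parity_of_piYddCharacteristic_modelχq` — **`hcharY ⟹ L_Ÿ♯`**; `piYddCharacteristic_modelχq_iff_parity` — `hcharY ⟺ L_Ÿ♯`: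
  at the stage-2 models (H1) IS the parity law, nothing more and nothing less;
* `parityOnDeltaY_of_piYddCharacteristic_modelχq` — abc-iut-w4-d044's `L_Ÿ` (the same on `Δ^tp_Y ∩ H`) as a corollary;
* bookkeeping: `mem_GtpY_modelχq_iff_gfpSnd`, `mem_GtpYdd_modelχq_iff_parity` (membership in `Π^tp_Y` / `Π^tp_Ÿ` read on
  the `Γ`-component), and the generic `piYddCharacteristic_iff_isTopCharacteristic` (any theta setting:
  (H1) is the tree's `IsTopCharacteristic Π^tp_{X̲̲} (Π^tp_Ÿ ∩ Π^tp_{X̲̲})`, the `Π•_Ÿ`-clause shape of [EtTh] Cor. 2.18 (i)).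

HONEST FRAMING.  `L_Ÿ♯` is a DISPLAYED HYPOTHESIS here (a signature binder, not a `Prop` fact); at the record instance it
is COMPUTATION-CERTIFIED by abc-iut-w5-d145 (computed ≠ proved; no kernel certificate is claimed by this file).
`modelχq` is a SEMI-SYNTHETIC model of the typed [EtTh] §1 interface (not the tempered `π₁` of a curve): the theorems
are classical topological-group facts about OUR typing and say what the binder (H1) amounts to there; nothing of
[IUTchII] (claim key `Mochizuki2012`, DISPUTED, D-0012) or [EtTh] is asserted; no side is taken on [IUTchIII] Cor. 3.12;
typed ≠ proved; instantiated ≠ endorsed; nothing here says abc is proved or refuted.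
-/

noncomputable section

namespace Literature.IUT.HodgeArakelov

open Literature.AnabelianGeometry.EtaleTheta Literature.AnabelianGeometry.SemiGraphs
open Literature.AnabelianGeometry.EtaleTheta.SettingModel
open scoped Literature.AnabelianGeometry.EtaleTheta

namespace ModelTateCarriers

/-! ## §0. (H1) as the tree's `IsTopCharacteristic` (any theta setting) -/

section Generic

variable {p : ℕ} [Fact p.Prime] {D : Literature.AnabelianGeometry.EtaleTheta.ThetaSetting p}
  {E : D.EtaleThetaData} {l : ℕ} (C : E.DoubleUnderline l)

/-- `Π_Ÿ(Π) = (Π^tp_Ÿ ∩ Π^tp_{X̲̲})|_{Π^tp_{X̲̲}}` is `Π^tp_Ÿ|_{Π^tp_{X̲̲}}` (the intersection with `Π^tp_{X̲̲}` is automatic inside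
`Π^tp_{X̲̲}`). [claim: Mochizuki2012, status: disputed] (IUTchII §1 Prop 1.4, kurims p.27) -/
theorem piYdd_eq_GtpYdd_subgroupOf : EtaleThetaDataOfSetting.PiYdd C = D.GtpYdd.subgroupOf C.Huu := by
  ext h
  simp only [Subgroup.mem_subgroupOf, Subgroup.mem_inf]
  exact ⟨fun hh => hh.1, fun hh => ⟨hh, h.2⟩⟩

/-- **(H1) `PiYddCharacteristic C` is the tree's `IsTopCharacteristic Π^tp_{X̲̲} (Π^tp_Ÿ|_{Π^tp_{X̲̲}})`** — the shape of
the `Π•_Ÿ`-clause of [EtTh] Cor. 2.18 (i) at the `X̲̲`-level, for ANY theta setting. [cite: MochizukiEtTh2009, Cor 2.18 (i) p.60] -/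
theorem piYddCharacteristic_iff_isTopCharacteristic :
    EtaleThetaDataOfSetting.PiYddCharacteristic C ↔ IsTopCharacteristic C.Huu (D.GtpYdd.subgroupOf C.Huu) := by
  unfold EtaleThetaDataOfSetting.PiYddCharacteristic IsTopCharacteristic
  rw [piYdd_eq_GtpYdd_subgroupOf]

end Generic

/-! ## §1. Membership in `Π^tp_Y` / `Π^tp_Ÿ` at the stage-2 models, read on the `Γ`-component -/

section StageTwo

variable (p : ℕ) [Fact p.Prime] (i j : ℤ) (hj : Even j)

/-- At `modelχq p i j hj`: `g ∈ Π^tp_Y ↔ deg(g.left) = 0` (`Π^tp_Y = Ker(Π^tp_X ↠ Z)`, `toZ g = pr₂(g.left)`).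
[cite: MochizukiEtTh2009, §1 p.12] -/
theorem mem_GtpY_modelχq_iff_gfpSnd (g : PiTpχq p i j) :
    g ∈ (ThetaSetting.modelχq p i j hj).GtpY ↔ gfpSnd g.left = 1 := by
  show (tateTwistData₀ p i j).toZ g = 1 ↔ _
  rw [GfpTwistData₀.toZ_apply]

/-- At `modelχq p i j hj` (`K₂ = J̈₁ = K̈ = ℚ_p`, so no Galois condition): **`g ∈ Π^tp_Ÿ ↔ deg(g.left) = 0 ∧ ĥ₂(g.left).y = 0`**
— membership in `Π^tp_Ÿ = Π^tp_{Y₂}` is the vanishing of the level-`2` `y`-coordinate on the degree-`0` part.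
[cite: MochizukiEtTh2009, §1 p.17] -/
theorem mem_GtpYdd_modelχq_iff_parity (g : PiTpχq p i j) :
    g ∈ (ThetaSetting.modelχq p i j hj).GtpYdd ↔ gfpSnd g.left = 1 ∧ (levelHom 2 g.left).y = 0 := by
  rw [mem_GtpYdd_modelχq_iff_left p i j hj]
  constructor
  · intro h
    obtain ⟨h0, hz⟩ := Subgroup.mem_inf.mp h
    obtain ⟨-, hy⟩ := Subgroup.mem_comap.mp hz
    exact ⟨h0, hy⟩
  · rintro ⟨h0, hy⟩
    exact Subgroup.mem_inf.mpr ⟨h0, Subgroup.mem_comap.mpr ⟨levelHom_x_eq_zero h0, hy⟩⟩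

/-- In `ℤ/2ℤ` two elements with the same zero-ness are equal. [folklore] -/
private theorem zmod_two_eq_of_iff {a b : ZMod (2 : ℕ+)} (h : a = 0 ↔ b = 0) : a = b := by
  change ZMod 2 at a b
  change (a = 0 ↔ b = 0) at h
  have key : ∀ c : ZMod 2, c ≠ 0 → c = 1 := by decide
  by_cases ha : a = 0
  · rw [ha, h.mp ha]
  · rw [key a ha, key b fun hb => ha (h.mpr hb)]

variable {E : (ThetaSetting.modelχq p i j hj).EtaleThetaData} {l : ℕ} (C : E.DoubleUnderline l)

/-- At `modelχq`: an element `g ∈ Π^tp_{X̲̲}` lies in `Π_Ÿ(Π) = Π^tp_Ÿ ∩ Π^tp_{X̲̲}` iff `deg(g.left) = 0 ∧ ĥ₂(g.left).y = 0`.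
[claim: Mochizuki2012, status: disputed] (IUTchII §1 Prop 1.4, kurims p.27) -/
theorem mem_piYdd_modelχq_iff_parity (g : C.Huu) :
    g ∈ EtaleThetaDataOfSetting.PiYdd C ↔
      gfpSnd (g : PiTpχq p i j).left = 1 ∧ (levelHom 2 (g : PiTpχq p i j).left).y = 0 := by
  rw [piYdd_eq_GtpYdd_subgroupOf, Subgroup.mem_subgroupOf]
  exact mem_GtpYdd_modelχq_iff_parity p i j hj (g : PiTpχq p i j)

/-! ## §2. `L_Ÿ♯ ⟹ hcharY` -/

/-- The degree-`0` part `Π^tp_Y ∩ Π^tp_{X̲̲}` is stable under every topological automorphism `α` of `Π^tp_{X̲̲}` at the stage-2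
models (the hypothesis-free `Y`-clause `isTopCharacteristic_GtpY_subgroupOf_Huu_modelχq`), read on degrees:
`deg(g.left) = 0 → deg((α g).left) = 0`. [cite: MochizukiEtTh2009, Prop 2.4 p.38] -/
theorem gfpSnd_map_eq_one_modelχq (α : ↥C.Huu ≃ₜ* ↥C.Huu) (g : C.Huu) (hg0 : gfpSnd (g : PiTpχq p i j).left = 1) :
    gfpSnd ((α g : ↥C.Huu) : PiTpχq p i j).left = 1 := by
  have hY := isTopCharacteristic_GtpY_subgroupOf_Huu_modelχq p i j hj C
  have hgY : g ∈ (ThetaSetting.modelχq p i j hj).GtpY.subgroupOf C.Huu :=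
    Subgroup.mem_subgroupOf.mpr ((mem_GtpY_modelχq_iff_gfpSnd p i j hj _).mpr hg0)
  have hαgY : α g ∈ (ThetaSetting.modelχq p i j hj).GtpY.subgroupOf C.Huu := by
    rw [← hY α]
    exact ⟨g, hgY, rfl⟩
  exact (mem_GtpY_modelχq_iff_gfpSnd p i j hj _).mp (Subgroup.mem_subgroupOf.mp hαgY)

/-- **`L_Ÿ♯ ⟹ hcharY` (the one-term closer).**  At `ThetaSetting.modelχq p i j hj` (any prime `p`, any `i`, even `j`), for
EVERY étale-theta datum `E` and EVERY choice `X̲̲` (`C`): if every topological automorphism `α` of `H := Π^tp_{X̲̲}` preserves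
the level-`2` `y`-parity on the degree-`0` part `Π^tp_Y ∩ H` — abc-iut-w5-d145's **L_Ÿ♯**, verbatim — then (H1)
`PiYddCharacteristic C` (= F-2633 at the instance: every `α` stabilises `Π^tp_Ÿ ∩ H`) holds.  Proof: the `Y`-clause is a
theorem (`isTopCharacteristic_GtpY_subgroupOf_Huu_modelχq`), `Π^tp_Ÿ = {deg 0, y₂ = 0}` (`K₂ = J̈₁ = ℚ_p`), parity is
transported by `L_Ÿ♯`, and the reverse inclusion comes from `α.symm`.  `L_Ÿ♯` is a DISPLAYED HYPOTHESIS
(COMPUTATION-CERTIFIED at the record instance by abc-iut-w5-d145, kit j266770; computed ≠ proved).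
[claim: Mochizuki2012, status: disputed] (IUTchII §1 Prop 1.4, kurims p.27) -/
theorem piYddCharacteristic_modelχq_of_parity
    (hLY : ∀ α : ↥C.Huu ≃ₜ* ↥C.Huu, ∀ g : ↥C.Huu, gfpSnd (g : PiTpχq p i j).left = 1 →
      (levelHom 2 ((α g : ↥C.Huu) : PiTpχq p i j).left).y = (levelHom 2 (g : PiTpχq p i j).left).y) :
    EtaleThetaDataOfSetting.PiYddCharacteristic C := by
  -- one inclusion, for every `α`
  have hle : ∀ α : ↥C.Huu ≃ₜ* ↥C.Huu,
      (EtaleThetaDataOfSetting.PiYdd C).map α.toMulEquiv.toMonoidHom ≤ EtaleThetaDataOfSetting.PiYdd C := by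
    intro α
    rintro _ ⟨g, hg, rfl⟩
    obtain ⟨hg0, hgy⟩ := (mem_piYdd_modelχq_iff_parity p i j hj C g).mp hg
    have hαg0 : gfpSnd ((α g : ↥C.Huu) : PiTpχq p i j).left = 1 := gfpSnd_map_eq_one_modelχq p i j hj C α g hg0
    have hαgy : (levelHom 2 ((α g : ↥C.Huu) : PiTpχq p i j).left).y = 0 := by rw [hLY α g hg0, hgy]
    exact (mem_piYdd_modelχq_iff_parity p i j hj C (α g)).mpr ⟨hαg0, hαgy⟩
  intro α
  refine le_antisymm (hle α) fun g hg => ⟨α.symm g, hle α.symm ⟨g, hg, rfl⟩, ?_⟩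
  exact α.apply_symm_apply g

/-! ## §3. `hcharY ⟹ L_Ÿ♯`, hence `hcharY ⟺ L_Ÿ♯` -/

/-- **`hcharY ⟹ L_Ÿ♯` (the converse).**  At the stage-2 models, (H1) forces every topological automorphism of `Π^tp_{X̲̲}`
to preserve the level-`2` `y`-parity on `Π^tp_Y ∩ Π^tp_{X̲̲}`: membership in `Π^tp_Ÿ ∩ Π^tp_{X̲̲}` is `α`-invariant by (H1),
the degree-`0` part is `α`-invariant by the `Y`-clause theorem, and on the degree-`0` part membership in `Π^tp_Ÿ` IS
«`y₂ = 0`» — two elements of `ℤ/2ℤ` with the same zero-ness are equal.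
[claim: Mochizuki2012, status: disputed] (IUTchII §1 Prop 1.4, kurims p.27) -/
theorem parity_of_piYddCharacteristic_modelχq (hchar : EtaleThetaDataOfSetting.PiYddCharacteristic C)
    (α : ↥C.Huu ≃ₜ* ↥C.Huu) (g : C.Huu) (hg0 : gfpSnd (g : PiTpχq p i j).left = 1) :
    (levelHom 2 ((α g : ↥C.Huu) : PiTpχq p i j).left).y = (levelHom 2 (g : PiTpχq p i j).left).y := by
  have hαg0 : gfpSnd ((α g : ↥C.Huu) : PiTpχq p i j).left = 1 := gfpSnd_map_eq_one_modelχq p i j hj C α g hg0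
  -- membership in `Π_Ÿ(Π)` is `α`-invariant by (H1)
  have key : α g ∈ EtaleThetaDataOfSetting.PiYdd C ↔ g ∈ EtaleThetaDataOfSetting.PiYdd C := by
    constructor
    · intro h
      have h' : α g ∈ (EtaleThetaDataOfSetting.PiYdd C).map α.toMulEquiv.toMonoidHom := by
        rw [hchar α]
        exact h
      obtain ⟨g', hg', hgg'⟩ := h'
      have hg'g : g' = g := α.injective hgg'
      rw [← hg'g]
      exact hg'
    · intro h
      rw [← hchar α]
      exact ⟨g, h, rfl⟩
  -- … and on the degree-`0` part it reads «`y₂ = 0`»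
  rw [mem_piYdd_modelχq_iff_parity p i j hj C, mem_piYdd_modelχq_iff_parity p i j hj C] at key
  exact zmod_two_eq_of_iff
    ⟨fun h => (key.mp ⟨hαg0, h⟩).2, fun h => (key.mpr ⟨hg0, h⟩).2⟩

/-- **`hcharY ⟺ L_Ÿ♯` at the stage-2 models** — for every `p`, `(i, j)` with `j` even, `E`, `l`, `X̲̲`: the K-L6 binder (H1)
`PiYddCharacteristic C` (F-2633@instance) is EXACTLY abc-iut-w5-d145's level-2 parity law on `Π^tp_Y ∩ Π^tp_{X̲̲}`.
[claim: Mochizuki2012, status: disputed] (IUTchII §1 Prop 1.4, kurims p.27) -/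
theorem piYddCharacteristic_modelχq_iff_parity :
    EtaleThetaDataOfSetting.PiYddCharacteristic C ↔
      ∀ α : ↥C.Huu ≃ₜ* ↥C.Huu, ∀ g : ↥C.Huu, gfpSnd (g : PiTpχq p i j).left = 1 →
        (levelHom 2 ((α g : ↥C.Huu) : PiTpχq p i j).left).y = (levelHom 2 (g : PiTpχq p i j).left).y :=
  ⟨fun hchar α g hg0 => parity_of_piYddCharacteristic_modelχq p i j hj C hchar α g hg0,
    piYddCharacteristic_modelχq_of_parity p i j hj C⟩

/-- **abc-iut-w4-d044's `L_Ÿ` as a corollary of (H1)**: the parity law restricted to `D₁ := Δ^tp_Y ∩ Π^tp_{X̲̲}` (trivial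
Galois component, `g.right = 1`).  NOTE: this `Δ`-only form is implied by, but does NOT conversely give, (H1) — the
cocycle clause of `L_Ÿ♯` at the Galois components is extra (abc-iut-w5-d145, STATUS 2026-08-27T03:58:17Z).
[claim: Mochizuki2012, status: disputed] (IUTchII §1 Prop 1.4, kurims p.27) -/
theorem parityOnDeltaY_of_piYddCharacteristic_modelχq (hchar : EtaleThetaDataOfSetting.PiYddCharacteristic C)
    (α : ↥C.Huu ≃ₜ* ↥C.Huu) (g : C.Huu) (_hΔ : (g : PiTpχq p i j).right = 1)
    (hg0 : gfpSnd (g : PiTpχq p i j).left = 1) :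
    (levelHom 2 ((α g : ↥C.Huu) : PiTpχq p i j).left).y = (levelHom 2 (g : PiTpχq p i j).left).y :=
  parity_of_piYddCharacteristic_modelχq p i j hj C hchar α g hg0

/-- **(H1) from `L_Ÿ♯`, in the tree's `IsTopCharacteristic` currency** (the `X̲̲`-level `Π•_Ÿ`-clause shape of [EtTh]
Cor. 2.18 (i)): `L_Ÿ♯ ⟹ IsTopCharacteristic Π^tp_{X̲̲} (Π^tp_Ÿ|_{Π^tp_{X̲̲}})` at the stage-2 models.
[cite: MochizukiEtTh2009, Cor 2.18 (i) p.60] -/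
theorem isTopCharacteristic_GtpYdd_subgroupOf_Huu_modelχq_of_parity
    (hLY : ∀ α : ↥C.Huu ≃ₜ* ↥C.Huu, ∀ g : ↥C.Huu, gfpSnd (g : PiTpχq p i j).left = 1 →
      (levelHom 2 ((α g : ↥C.Huu) : PiTpχq p i j).left).y = (levelHom 2 (g : PiTpχq p i j).left).y) :
    IsTopCharacteristic C.Huu ((ThetaSetting.modelχq p i j hj).GtpYdd.subgroupOf C.Huu) :=
  (piYddCharacteristic_iff_isTopCharacteristic C).mp (piYddCharacteristic_modelχq_of_parity p i j hj C hLY)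

end StageTwo

end ModelTateCarriers

end Literature.IUT.HodgeArakelov

end
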